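import Summits.NavierStokesRegularity.NavierStokesRegularity.Theorems.ThreadingFluxCentreVirialHodgeSlaving
import HarnessLib

/-!
# Crux `PoloidalLiouville` (stmt-NavierStokesRegularity-1222, W1), crux idea «centre-virial» (ns-idea-15 g9):
# Hodge slaving, sphere-free — VII: the mollification toolkit on `ℝ³`

* mollification toolkit on `ℝ³`: `bumpSeq`, `mollify` (`φ_n ⋆ v`), `fderiv_mollify` (Mathlib
  `HasCompactSupport.hasFDerivAt_convolution_right`: `D(φ_n ⋆ v) = φ_n ⋆ Dv` for `v ∈ C¹_c`), `mollify_uniform` /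
  `tendsto_mollify` / `eventually_norm_mollify_le` (uniform approximation on balls, from `ContDiffBump.dist_normed_convolution_le`
  and uniform continuity), the radial cut-off `ballCut` / `cutField`, and `divergence_mollify_cutField` (the mollified cut-off
  field is divergence-free on the shell);
* `Hodge.hodgeSlavingShell_C1`: H for `C¹` fields — H″ (`hodgeSlavingShell_C2_defect`) for `u_n = φ_n ⋆ (χu)` and
  `n → ∞` (dominated convergence on the shell; the defect tends to `∫⟪curl u, y⟫²/r³ = 0`);
* ★★★ `hodgeSlavingShell : HodgeSlavingShell` — the card's H by name over the twin `ThreadingFluxCentreVirialDefs`.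

With this file every non-conjecture statement of the centre-virial card (V0, V1, V1′, F1, F2, B, T1, H, T2) is a tree
/-- Auxiliary. -/
theorem by name; open remain the conjectures T0 `SteadyPoloidalDLiouville` / Galdi and W1ᴰ (⇐ T0).
Part of the sphere-free proof of Hodge slaving (H of the centre-virial card, ns-idea-15 g9; twin
`ThreadingFluxCentreVirialDefs`).  Folklore analysis re-derived in ambient coordinates; information-grade; W1 movement 0;
`PoloidalLiouville` (1222), T0, Galdi's problem OPEN; NS regularity is NOT proved.
`--supports stmt-NavierStokesRegularity-1222 --as helper`.  Filed by ns-wall-eng-4 g6 (cell ns-wall-extremal).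
[cite: KorobkovPileckasRusso2015, Thm 3.6]
-/

-- the summit and its single sub-problem share the name (CONVENTIONS §1)
set_option linter.dupNamespace false

noncomputable section

namespace Summit.NavierStokesRegularity.NavierStokesRegularity.Theorems.PoloidalLiouville.CentreVirial

open Set Function MeasureTheory Filter Topology
open Literature.Analysis.FluidPDE
open Literature.Analysis.FluidPDE.VectorCalculus (divergence IsDivFree)
open Summit.NavierStokesRegularity.NavierStokesRegularity.Theorems.PoloidalLiouville.CentreJet
  (E3 IsUnthreadedAbout IsSteadyNSOn)
open scoped RealInnerProductSpace

namespace Hodge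

/-! ### Mollification: H for `C¹` fields from H″ for `C²` fields -/

section Mollify
open scoped Convolution
open ContinuousLinearMap (lsmul)

variable {u : E3 → E3} {x₀ : E3}

/-- `radialFluxDeriv` through the velocity and its derivative: `D = 2⟪y, u⟫ + ⟪y, Du y⟫`. -/
theorem radialFluxDeriv_eq {x : E3} (hu : DifferentiableAt ℝ u x) :
    radialFluxDeriv x₀ u x = 2 * ⟪x - x₀, u x⟫ + ⟪x - x₀, fderiv ℝ u x (x - x₀)⟫ := by
  have hyd : DifferentiableAt ℝ (fun z : E3 => z - x₀) x := differentiableAt_id.sub_const x₀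
  unfold radialFluxDeriv mom
  rw [show (fun z => ⟪z - x₀, u z⟫) = fun z => ⟪z - x₀, u z⟫ from rfl,
    fderiv_inner_apply ℝ hyd hu, fderiv_sub_const, fderiv_fun_id, ContinuousLinearMap.id_apply,
    real_inner_comm (u x) (x - x₀)]
  ring

/-- The bump sequence `φ_n` (supported in the ball of radius `1/(n+1)`). -/
def bumpSeq (n : ℕ) : ContDiffBump (0 : E3) :=
  ⟨1 / ((n : ℝ) + 2), 1 / ((n : ℝ) + 1), by positivity, by
    apply one_div_lt_one_div_of_lt (by positivity); linarith⟩

/-- The outer radius of `φ_n`. -/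
theorem bumpSeq_rOut (n : ℕ) : (bumpSeq n).rOut = 1 / ((n : ℝ) + 1) := rfl

/-- `rOut ≤ 1`. -/
theorem bumpSeq_rOut_le_one (n : ℕ) : (bumpSeq n).rOut ≤ 1 := by
  rw [bumpSeq_rOut, div_le_one (by positivity)]
  have : (0 : ℝ) ≤ n := Nat.cast_nonneg n
  linarith

/-- The mollified field `u_n = φ_n ⋆ v`. -/
def mollify (v : E3 → E3) (n : ℕ) : E3 → E3 := (bumpSeq n).normed volume ⋆[lsmul ℝ ℝ, volume] v

/-- Mollifications are smooth. -/
theorem mollify_contDiff {v : E3 → E3} (hv : Continuous v) (n : ℕ) {m : ℕ∞} : ContDiff ℝ m (mollify v n) :=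
  (bumpSeq n).hasCompactSupport_normed.contDiff_convolution_left _ (bumpSeq n).contDiff_normed
    hv.locallyIntegrable

/-- `(lsmul).precompR = lsmul` on operator-valued functions (both are `a ↦ (M ↦ a • M)`). -/
theorem precompR_lsmul_eq :
    ((lsmul ℝ ℝ : ℝ →L[ℝ] E3 →L[ℝ] E3).precompR E3 : ℝ →L[ℝ] (E3 →L[ℝ] E3) →L[ℝ] (E3 →L[ℝ] E3)) =
      (lsmul ℝ ℝ : ℝ →L[ℝ] (E3 →L[ℝ] E3) →L[ℝ] (E3 →L[ℝ] E3)) := by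
  ext a M h
  simp [ContinuousLinearMap.precompR]

/-- The derivative of the mollified field is the mollified derivative (`v ∈ C¹` with compact support). -/
theorem fderiv_mollify {v : E3 → E3} (hv : ContDiff ℝ 1 v) (hvc : HasCompactSupport v) (n : ℕ) (x : E3) :
    fderiv ℝ (mollify v n) x = ((bumpSeq n).normed volume ⋆[lsmul ℝ ℝ, volume] fderiv ℝ v) x := by
  have h := hvc.hasFDerivAt_convolution_right (lsmul ℝ ℝ : ℝ →L[ℝ] E3 →L[ℝ] E3) (μ := volume)
    (f := (bumpSeq n).normed volume) (((bumpSeq n).continuous_normed (μ := volume)).locallyIntegrable) hv x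
  rw [precompR_lsmul_eq] at h
  exact h.fderiv

/-- **Uniform approximation by mollification on a ball**: for a continuous `g` and `ε > 0`, eventually
`dist((φ_n ⋆ g)(x), g x) ≤ ε` for all `x` in `closedBall x₀ b` (uniform continuity on `closedBall x₀ (b + 1)`). -/
theorem mollify_uniform {F' : Type*} [NormedAddCommGroup F'] [NormedSpace ℝ F'] [CompleteSpace F']
    {g : E3 → F'} (hg : Continuous g) (x₀ : E3) (b : ℝ) {ε : ℝ} (hε : 0 < ε) :
    ∀ᶠ n : ℕ in atTop, ∀ x ∈ Metric.closedBall x₀ b,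
      dist (((bumpSeq n).normed volume ⋆[lsmul ℝ ℝ, volume] g) x) (g x) ≤ ε := by
  have hK : IsCompact (Metric.closedBall x₀ (b + 1)) := isCompact_closedBall _ _
  have huc := hK.uniformContinuousOn_of_continuous hg.continuousOn
  rw [Metric.uniformContinuousOn_iff] at huc
  obtain ⟨δ, hδ, hδε⟩ := huc ε hε
  obtain ⟨N, hN⟩ := exists_nat_gt (1 / δ)
  refine Filter.eventually_atTop.2 ⟨N, fun n hn x hx => ?_⟩
  have hrout : (bumpSeq n).rOut < δ := by
    rw [bumpSeq_rOut, div_lt_iff₀ (by positivity)]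
    have hN' : (N : ℝ) ≤ n := by exact_mod_cast hn
    have : 1 / δ * δ = 1 := by field_simp
    nlinarith
  refine (bumpSeq n).dist_normed_convolution_le hg.aestronglyMeasurable fun x' hx' => ?_
  rw [Metric.mem_closedBall] at hx
  rw [Metric.mem_ball] at hx'
  have h1 : x' ∈ Metric.closedBall x₀ (b + 1) := by
    rw [Metric.mem_closedBall]
    calc dist x' x₀ ≤ dist x' x + dist x x₀ := dist_triangle _ _ _
      _ ≤ 1 + b := by linarith [hx'.le.trans (bumpSeq_rOut_le_one n)]
      _ = b + 1 := by ring
  have h2 : x ∈ Metric.closedBall x₀ (b + 1) := by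
    rw [Metric.mem_closedBall]; linarith
  exact (hδε x' h1 x h2 (hx'.trans hrout)).le

/-- The smooth radial cut-off about `x₀`: `= 1` on `closedBall x₀ (b+1)` (indeed on a neighbourhood), `= 0` off
`ball x₀ (b+2)`. -/
def ballCut (x₀ : E3) (b : ℝ) (x : E3) : ℝ := Real.smoothTransition ((b + 2) ^ 2 - ‖x - x₀‖ ^ 2)

/-- The cut-off is smooth. -/
theorem ballCut_contDiff (x₀ : E3) (b : ℝ) {n : ℕ∞} : ContDiff ℝ n (ballCut x₀ b) :=
  Real.smoothTransition.contDiff.comp (contDiff_const.sub ((contDiff_id.sub contDiff_const).norm_sq ℝ))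

/-- The cut-off is `1` on `ball x₀ (b+1)`. -/
theorem ballCut_eq_one {x₀ : E3} {b : ℝ} (hb : 0 < b) {x : E3} (hx : ‖x - x₀‖ < b + 1) : ballCut x₀ b x = 1 := by
  refine Real.smoothTransition.one_of_one_le ?_
  have h0 : 0 ≤ ‖x - x₀‖ := norm_nonneg _
  nlinarith

/-- The cut-off vanishes off `ball x₀ (b+2)`. -/
theorem ballCut_eq_zero {x₀ : E3} {b : ℝ} (hb : 0 < b) {x : E3} (hx : b + 2 ≤ ‖x - x₀‖) : ballCut x₀ b x = 0 := by
  refine Real.smoothTransition.zero_of_nonpos ?_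
  have h0 : 0 < b + 2 := by linarith
  nlinarith

/-- The cut-off field `v = χ u`: `C¹`, compactly supported, `= u` near `closedBall x₀ (b+1)`. -/
def cutField (x₀ : E3) (b : ℝ) (u : E3 → E3) (x : E3) : E3 := ballCut x₀ b x • u x

/-- `χ u` is `C¹`. -/
theorem cutField_contDiff {b : ℝ} (hu : ContDiff ℝ 1 u) : ContDiff ℝ 1 (cutField x₀ b u) :=
  (ballCut_contDiff x₀ b).smul hu

/-- `χ u` has compact support. -/
theorem cutField_hasCompactSupport {b : ℝ} (hb : 0 < b) (u : E3 → E3) : HasCompactSupport (cutField x₀ b u) := by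
  refine HasCompactSupport.intro (isCompact_closedBall x₀ (b + 2)) fun x hx => ?_
  rw [Metric.mem_closedBall, dist_eq_norm, not_le] at hx
  show ballCut x₀ b x • u x = 0
  rw [ballCut_eq_zero hb hx.le, zero_smul]

/-- `χ u = u` near every point of `ball x₀ (b+1)`. -/
theorem cutField_eventuallyEq {b : ℝ} (hb : 0 < b) {x : E3} (hx : ‖x - x₀‖ < b + 1) :
    cutField x₀ b u =ᶠ[𝓝 x] u := by
  have hopen : IsOpen {z : E3 | ‖z - x₀‖ < b + 1} :=
    isOpen_lt (continuous_norm.comp (continuous_id.sub continuous_const)) continuous_const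
  refine Filter.eventuallyEq_of_mem (hopen.mem_nhds hx) fun z hz => ?_
  show ballCut x₀ b z • u z = u z
  rw [ballCut_eq_one hb hz, one_smul]

/-- The mollified cut-off field is divergence-free on `ball x₀ b` when `u` is divergence-free on `ball x₀ (b+1)`. -/
theorem divergence_mollify_cutField {b : ℝ} (hb : 0 < b) (hu : ContDiff ℝ 1 u)
    (hdiv : ∀ z, ‖z - x₀‖ < b + 1 → divergence u z = 0) (n : ℕ) {x : E3} (hx : ‖x - x₀‖ < b) :
    divergence (mollify (cutField x₀ b u) n) x = 0 := by
  set v := cutField x₀ b u with hv_def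
  have hv : ContDiff ℝ 1 v := cutField_contDiff hu
  have hvc : HasCompactSupport v := cutField_hasCompactSupport hb u
  rw [divergence_eq_traceCLM, fderiv_mollify hv hvc n x, convolution_def]
  have hint : Integrable (fun t : E3 => (lsmul ℝ ℝ ((bumpSeq n).normed volume t)) (fderiv ℝ v (x - t))) volume := by
    refine (Continuous.integrable_of_hasCompactSupport ?_ ?_)
    · exact ((bumpSeq n).continuous_normed.smul ((hv.continuous_fderiv one_ne_zero).comp (continuous_const.sub continuous_id)))
    · exact (bumpSeq n).hasCompactSupport_normed.smul_right
  rw [← (traceCLM : (E3 →L[ℝ] E3) →L[ℝ] ℝ).integral_comp_comm hint]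
  refine integral_eq_zero_of_ae (Eventually.of_forall fun t => ?_)
  show traceCLM ((lsmul ℝ ℝ ((bumpSeq n).normed volume t)) (fderiv ℝ v (x - t))) = 0
  rw [ContinuousLinearMap.lsmul_apply, map_smul]
  by_cases ht : (bumpSeq n).normed volume t = 0
  · rw [ht, zero_smul]
  · have ht' : t ∈ Function.support ((bumpSeq n).normed volume) := ht
    rw [(bumpSeq n).support_normed_eq, Metric.mem_ball, dist_zero_right] at ht'
    have hxt : ‖(x - t) - x₀‖ < b + 1 := by
      calc ‖(x - t) - x₀‖ = ‖(x - x₀) - t‖ := by congr 1; abel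
        _ ≤ ‖x - x₀‖ + ‖t‖ := norm_sub_le _ _
        _ < b + 1 := by linarith [ht'.le.trans (bumpSeq_rOut_le_one n)]
    have hfd : fderiv ℝ v (x - t) = fderiv ℝ u (x - t) := (cutField_eventuallyEq hb hxt).fderiv_eq
    rw [← divergence_eq_traceCLM, show VectorCalculus.divergence v (x - t) = divergence u (x - t) by
      unfold VectorCalculus.divergence; rw [hfd], hdiv _ hxt, smul_zero]

/-- Pointwise convergence of the mollifications on `closedBall x₀ b`. -/
theorem tendsto_mollify {F' : Type*} [NormedAddCommGroup F'] [NormedSpace ℝ F'] [CompleteSpace F']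
    {g : E3 → F'} (hg : Continuous g) {x₀ : E3} {b : ℝ} {x : E3} (hx : x ∈ Metric.closedBall x₀ b) :
    Tendsto (fun n : ℕ => ((bumpSeq n).normed volume ⋆[lsmul ℝ ℝ, volume] g) x) atTop (𝓝 (g x)) := by
  rw [Metric.tendsto_atTop]
  intro ε hε
  obtain ⟨N, hN⟩ := Filter.eventually_atTop.1 (mollify_uniform hg x₀ b (half_pos hε))
  exact ⟨N, fun n hn => lt_of_le_of_lt (hN n hn x hx) (half_lt_self hε)⟩

/-- Eventually-uniform bound for the mollifications on `closedBall x₀ b`. -/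
theorem eventually_norm_mollify_le {F' : Type*} [NormedAddCommGroup F'] [NormedSpace ℝ F'] [CompleteSpace F']
    {g : E3 → F'} (hg : Continuous g) (x₀ : E3) (b : ℝ) :
    ∃ C : ℝ, ∀ᶠ n : ℕ in atTop, ∀ x ∈ Metric.closedBall x₀ b,
      ‖((bumpSeq n).normed volume ⋆[lsmul ℝ ℝ, volume] g) x‖ ≤ C := by
  obtain ⟨C₀, hC₀⟩ := (isCompact_closedBall x₀ b).exists_bound_of_continuousOn hg.continuousOn
  refine ⟨C₀ + 1, (mollify_uniform hg x₀ b one_pos).mono fun n hn x hx => ?_⟩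
  have h1 := hn x hx
  rw [dist_eq_norm] at h1
  have h2 := hC₀ x hx
  calc ‖((bumpSeq n).normed volume ⋆[lsmul ℝ ℝ, volume] g) x‖
      = ‖(((bumpSeq n).normed volume ⋆[lsmul ℝ ℝ, volume] g) x - g x) + g x‖ := by rw [sub_add_cancel]
    _ ≤ ‖((bumpSeq n).normed volume ⋆[lsmul ℝ ℝ, volume] g) x - g x‖ + ‖g x‖ := norm_add_le _ _
    _ ≤ 1 + C₀ := add_le_add h1 h2
    _ = C₀ + 1 := by ring


end Mollify


end Hodge


end Summit.NavierStokesRegularity.NavierStokesRegularity.Theorems.PoloidalLiouville.CentreVirial
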